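import Literature.AlgebraicGeometry.HodgeTheory.BettiHodgeConjectureDegreeSymmetry
import HarnessLib

/-!
# The Hodge conjecture in codimension `p` as ONE RANK EQUALITY on the lane's carriers: `dim_ℂ Nᵖ(X) ≤ dim_ℚ Hdgᵖ(H^{2p}(X))` always, and `HCᵖ(X) ⟺ dim_ℂ Nᵖ(X) = dim_ℚ Hdgᵖ(H^{2p}(X))`;
# `HC(X) ⟺` these equalities for `2 ≤ p ≤ n/2`; `dim_ℂ N¹ = ρ(X)`, `dim_ℂ N^{n−1} = dim_ℚ Hdg^{n−1}`; fourfolds / fivefolds: `HC ⟺ dim_ℂ N² = dim_ℚ Hdg²(H⁴)`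
# (Voisin I §7.1.1, Prop. 11.20, §11.3.1, Thm. 11.30, Thm. 6.25; Grothendieck 1969; Deligne 2000 §1)

Family `hodge`, lane `lit-hodgefound` (Track 2 foundations library; Layers A1/A4), layer `Literature/AlgebraicGeometry/HodgeTheory`.  THEOREMS ONLY (no definition,
no named fact, no instance; D-0026 net debt `0`).  Sequel of the seat's g26-#4/#5 (`A(X, η)` as rank equalities; `HC` degree by degree).  On the lane's Hodge structure
`H^{2p}(X) = BettiUniverse.hodge hHD hX (2p)` on `H^{2p}(X(ℂ); ℚ) = bettiCohomology X (2p)` the `ℚ`-space of HODGE CLASSES is `Hdgᵖ(H^{2p}(X)) = (…).hodgeClasses p` and, inside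
`H^{2p}(X(ℂ); ℂ) = complexBetti X (2p)`, the `ℂ`-span of the ALGEBRAIC classes is `Nᵖ(X) = algebraicClasses X p`; `v ↦ v ⊗ 1` is `ofRatClass`.  «`HCᵖ(X)`» (prose only; spelled out inline) = every
rational `(p,p)`-class of `H^{2p}(X(ℂ); ℂ)` lies in `Nᵖ(X)`.

THE ARGUMENT.  (i) `Nᵖ ⊆ span_ℂ (Hdgᵖ ⊗ 1)`: `Nᵖ` is the `ℂ`-span of its rational classes («`Filt'` … `⊗ ℂ`», Grothendieck 1969; the tree's `supportedClasses_le_span_isRationalClass`) and an algebraic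
class is of type `(p,p)` (Voisin I Prop. 11.20), i.e. a rational algebraic class is `v ⊗ 1` with `v ∈ Hdgᵖ`.  (ii) `dim_ℂ span_ℂ(K ⊗ 1) = dim_ℚ K` for every `ℚ`-subspace `K ⊆ Hᵏ(X(ℂ); ℚ)`
(`Hᵏ(X, ℚ) ⊗ ℂ ↪ Hᵏ(X, ℂ)`, Voisin I §7.1.1; the tree's `ofRatClassBaseChange_injective`, and `ℂ ⊗_ℚ K ≅ K ⊗ ℂ` by flatness).  Hence `dim_ℂ Nᵖ ≤ dim_ℚ Hdgᵖ`, with equality iff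
`Nᵖ = span_ℂ(Hdgᵖ ⊗ 1)` iff every `v ⊗ 1`, `v ∈ Hdgᵖ`, is in `Nᵖ` iff `HCᵖ` (g26-#5's dictionary `BettiUniverse.forall_mem_hodgeClasses_hodge_iff`).

THE PRINTS.  C. Voisin (2002) [VoisinHodgeI2002] §7.1.1 («`Hᵏ(X, ℂ) = Hᵏ(X, ℚ) ⊗ ℂ`»), §11.1.2 Prop. 11.20 (the class of an analytic cycle is of type `(p,p)`), §11.3.1 Def. 11.28 / Rem. 11.29 / Conjecture 11.36
(Hodge classes `Hdg^{2k}(X)`; the Hodge conjecture), Thm. 11.30 (Lefschetz `(1,1)`), §6.2.3 Thm. 6.25.  A. Grothendieck (1969) [GrothendieckTopology1969] pp. 299–300 (the coniveau / support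
filtration is defined over `ℚ`).  P. Deligne (2000) [Deligne2000] §1 (statement of the conjecture: «`H^{2p}(X, ℚ) ∩ H^{p,p} = ` the `ℚ`-span of algebraic classes»).  D. Arapura (2012) [Arapura2012]
§11.2 (PDF p0177: `dim Hdg ≤ h^{p,p}`).

WHAT IS PROVED.
* §1 complexification of `ℚ`-subspaces: **`BettiUniverse.map_baseChange_ofRatClassBaseChange_eq_span`** (`β(K ⊗ ℂ) = span_ℂ(K ⊗ 1)`, the carriers' copy of the Griffiths-Jacobian file's
  lemma, which this layer may not cheaply import), **`BettiUniverse.finrank_span_image_ofRatClass`** (`dim_ℂ span_ℂ(K ⊗ 1) = dim_ℚ K`, every `ℚ`-subspace `K ⊆ Hᵏ(X(ℂ); ℚ)`).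
* §2 `Nᵖ` versus `Hdgᵖ`: `BettiUniverse.image_ofRatClass_hodgeClasses_hodge` (`Hdgᵖ ⊗ 1 = {rational (p,p)-classes}`), **`BettiUniverse.algebraicClasses_le_span_image_ofRatClass_hodgeClasses_hodge`**
  (`Nᵖ ⊆ span_ℂ(Hdgᵖ ⊗ 1)`), **`BettiUniverse.finrank_algebraicClasses_le_finrank_hodgeClasses_hodge`** (`dim_ℂ Nᵖ ≤ dim_ℚ Hdgᵖ`), `BettiUniverse.finrank_algebraicClasses_le_hodgeNumber_hodge`
  (`dim_ℂ Nᵖ ≤ h^{p,p}(X)`), **`BettiUniverse.finrank_algebraicClasses_eq_finrank_hodgeClasses_hodge_iff`** (`dim_ℂ Nᵖ = dim_ℚ Hdgᵖ ⟺ HCᵖ`),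
  `BettiUniverse.algebraicClasses_eq_span_image_ofRatClass_hodgeClasses_hodge_iff` (`Nᵖ = span_ℂ(Hdgᵖ ⊗ 1) ⟺ HCᵖ`).
* §3 the conjecture as rank equalities: **`BettiUniverse.hodgeConjectureFor_iff_forall_finrank_algebraicClasses_eq`** (`HC(X) ⟺ ∀ p, dim_ℂ Nᵖ = dim_ℚ Hdgᵖ`),
  **`BettiUniverse.hodgeConjectureFor_iff_forall_two_le_finrank_algebraicClasses_eq`** (`⟺` the same for `2 ≤ p ≤ n/2` only), the free degrees `BettiUniverse.finrank_algebraicClasses_eq_finrank_hodgeClasses_hodge_of_lefschetzRange`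
  (`p ≤ 1` or `p + 1 ≥ n`: `dim_ℂ Nᵖ = dim_ℚ Hdgᵖ`; `dim_ℂ N¹(X) = ρ(X)`), and the first dimensions with content `BettiUniverse.hodgeConjectureFor_iff_finrank_algebraicClasses_two_eq_of_dim_eq_four`
  (`HC(X⁴) ⟺ dim_ℂ N² = dim_ℚ Hdg²(H⁴)`), `…_of_dim_eq_five` (`HC(X⁵) ⟺ dim_ℂ N² = dim_ℚ Hdg²(H⁴)`).

DEVIATIONS / SCOPE.  No case of the conjecture is proved here; `dim_ℚ Hdgᵖ` itself is not computed (it is bounded by `h^{p,p}`, `BettiPicardNumberBounds`).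

## References
* [VoisinHodgeI2002] C. Voisin, *Hodge Theory and Complex Algebraic Geometry I* (2002) — §7.1.1; §11.1.2 Prop. 11.20; §11.3.1 Def. 11.28, Rem. 11.29, Conj. 11.36; Thm. 11.30; §6.2.3 Thm. 6.25.
* [GrothendieckTopology1969] A. Grothendieck, *Hodge's general conjecture is false for trivial reasons*, Topology 8 (1969) 299–303 — pp. 299–300.
* [Deligne2000] P. Deligne, *The Hodge conjecture* (Clay, 2000) — §1.
* [Arapura2012] D. Arapura, *Algebraic Geometry over the Complex Numbers* (2012) — §11.2 (PDF p. 177).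
* [HatcherAT2002] A. Hatcher, *Algebraic Topology* (2002) — §3.1 p. 198 (coefficients).

## Provenance
Lane `lit-hodgefound` (Hodge path, Track 2), prover seat `lit-hodgefound-p29` (generation 26), self-proposed row g26-#7 (sequel of g26-#4/#5/#6).
-/

noncomputable section

open scoped TensorProduct
open CategoryTheory Module Finset
open Literature.AlgebraicTopology.SingularHomology
open Literature.Geometry.Kaehler

namespace Literature.AlgebraicGeometry.HodgeTheory

open Literature.AlgebraicGeometry.Motives
open Literature.AlgebraicGeometry.Motives.HodgeStructure

variable {n : ℕ} {X : SchemeOver ℂ}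

/-! ### §1 Complexification of `ℚ`-subspaces of `Hᵏ(X(ℂ); ℚ)` inside `Hᵏ(X(ℂ); ℂ)` -/

/-- **`β(K ⊗ ℂ) = span_ℂ (K ⊗ 1)`**: the complexification of a `ℚ`-subspace `K ⊆ Hᵏ(X(ℂ); ℚ)`, pushed into `Hᵏ(X(ℂ); ℂ)` by `β = ofRatClassBaseChange` (`c ⊗ v ↦ c • (v ⊗ 1)`), is the `ℂ`-span of
the classes `v ⊗ 1`, `v ∈ K` (the carriers' copy of the tree's `map_ofRatClassBaseChange_baseChange_eq_span`, file `GriffithsJacobianAlgebraicPartOfHodgeModel`). [cite: VoisinHodgeI2002, §7.1.1]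
[cite: HatcherAT2002, §3.1 p. 198] -/
theorem BettiUniverse.map_baseChange_ofRatClassBaseChange_eq_span {k : ℕ} (K : Submodule ℚ (bettiCohomology X k)) :
    (K.baseChange ℂ).map (ofRatClassBaseChange (ComplexPoints X) k) = Submodule.span ℂ (ofRatClass (ComplexPoints X) k '' (K : Set (bettiCohomology X k))) := by
  refine le_antisymm ?_ ?_
  · rw [Submodule.baseChange_eq_span, Submodule.map_span, Submodule.span_le]
    rintro _ ⟨_, ⟨v, hv, rfl⟩, rfl⟩
    refine Submodule.subset_span ⟨v, hv, ?_⟩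
    change _ = ofRatClassBaseChange _ k ((TensorProduct.mk ℚ ℂ _ 1) v)
    rw [TensorProduct.mk_apply, ofRatClassBaseChange_tmul, one_smul]
  · rw [Submodule.span_le]
    rintro _ ⟨v, hv, rfl⟩
    refine ⟨(1 : ℂ) ⊗ₜ[ℚ] v, Submodule.tmul_mem_baseChange_of_mem 1 hv, ?_⟩
    rw [ofRatClassBaseChange_tmul, one_smul]

/-- **`dim_ℂ span_ℂ (K ⊗ 1) = dim_ℚ K`** for every `ℚ`-subspace `K ⊆ Hᵏ(X(ℂ); ℚ)`: complexification does not change the dimension (`Hᵏ(X, ℚ) ⊗ ℂ ↪ Hᵏ(X, ℂ)`, the tree's `ofRatClassBaseChange_injective`;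
`ℂ ⊗_ℚ K ≅ K ⊗ ℂ`, flatness). [cite: VoisinHodgeI2002, §7.1.1] [cite: HatcherAT2002, §3.1 p. 198] -/
theorem BettiUniverse.finrank_span_image_ofRatClass {k : ℕ} (K : Submodule ℚ (bettiCohomology X k)) :
    Module.finrank ℂ (Submodule.span ℂ (ofRatClass (ComplexPoints X) k '' (K : Set (bettiCohomology X k)))) = Module.finrank ℚ K := by
  rw [← BettiUniverse.map_baseChange_ofRatClassBaseChange_eq_span K,
    ← (Submodule.equivMapOfInjective _ (ofRatClassBaseChange_injective (ComplexPoints X) k) (K.baseChange ℂ)).finrank_eq,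
    ← (Submodule.toBaseChange.toLinearEquiv ℂ K).finrank_eq, Module.finrank_baseChange]

/-! ### §2 `Nᵖ(X)` against `Hdgᵖ(H^{2p}(X))` -/

/-- **`Hdgᵖ ⊗ 1` is the set of rational `(p,p)`-classes of `H^{2p}(X(ℂ); ℂ)`** (rational classes are the `v ⊗ 1`; `v ∈ Hdgᵖ ⟺ v ⊗ 1` is of type `(p,p)`). [cite: VoisinHodgeI2002, §11.3.1 Def. 11.28 and §7.1.1] -/
theorem BettiUniverse.image_ofRatClass_hodgeClasses_hodge (hHD : exists_isReal_hodgeModel) (hX : IsSmoothProjective n X) (p : ℕ) :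
    ofRatClass (ComplexPoints X) (2 * p) '' ((BettiUniverse.hodge hHD hX (2 * p)).hodgeClasses p : Set (bettiCohomology X (2 * p))) =
      {c : complexBetti X (2 * p) | IsRationalClass c ∧ IsOfHodgeType n X (2 * p) p p c} := by
  ext c
  constructor
  · rintro ⟨v, hv, rfl⟩
    exact ⟨isRationalClass_ofRatClass _, (BettiUniverse.mem_hodgeClasses_hodge_iff_isOfHodgeType hHD hX p v).1 hv⟩
  · rintro ⟨hc, hpp⟩
    obtain ⟨v, rfl⟩ := (isRationalClass_iff_mem_range_ofRatClass c).1 hc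
    exact ⟨v, (BettiUniverse.mem_hodgeClasses_hodge_iff_isOfHodgeType hHD hX p v).2 hpp, rfl⟩

/-- **`Nᵖ(X) ⊆ span_ℂ (Hdgᵖ ⊗ 1)`**: the span of algebraic classes lies in the complex span of the Hodge classes (`Nᵖ` is spanned by its rational classes — Grothendieck 1969, the tree's
`supportedClasses_le_span_isRationalClass` — and algebraic classes are of type `(p,p)`, Prop. 11.20; compare the tree's `algebraicClasses_le_span_hodgeClasses`). [cite: GrothendieckTopology1969, pp. 299–300]
[cite: VoisinHodgeI2002, §11.1.2 Prop. 11.20 and §11.3.1] -/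
theorem BettiUniverse.algebraicClasses_le_span_image_ofRatClass_hodgeClasses_hodge (hHD : exists_isReal_hodgeModel) (hX : IsSmoothProjective n X) (p : ℕ) :
    algebraicClasses X p ≤ Submodule.span ℂ (ofRatClass (ComplexPoints X) (2 * p) '' ((BettiUniverse.hodge hHD hX (2 * p)).hodgeClasses p : Set (bettiCohomology X (2 * p)))) := by
  rw [BettiUniverse.image_ofRatClass_hodgeClasses_hodge hHD hX p]
  refine (supportedClasses_le_span_isRationalClass hX (2 * p) p).trans (Submodule.span_mono ?_)
  rintro c ⟨hc, hN⟩
  exact ⟨hc, isOfHodgeType_of_mem_algebraicClasses_of_isSmoothProjective hX p hN⟩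

/-- **`dim_ℂ Nᵖ(X) ≤ dim_ℚ Hdgᵖ(H^{2p}(X))`** for every smooth projective complex `X` and every `p` (unconditionally). [cite: VoisinHodgeI2002, §11.1.2 Prop. 11.20, §11.3.1 and §7.1.1] [cite: Deligne2000, §1] -/
theorem BettiUniverse.finrank_algebraicClasses_le_finrank_hodgeClasses_hodge (hHD : exists_isReal_hodgeModel) (hX : IsSmoothProjective n X) (p : ℕ) :
    Module.finrank ℂ (algebraicClasses X p) ≤ Module.finrank ℚ ((BettiUniverse.hodge hHD hX (2 * p)).hodgeClasses p) := by
  haveI := finite_complexBetti hX (2 * p)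
  rw [← BettiUniverse.finrank_span_image_ofRatClass ((BettiUniverse.hodge hHD hX (2 * p)).hodgeClasses p)]
  exact Submodule.finrank_mono (BettiUniverse.algebraicClasses_le_span_image_ofRatClass_hodgeClasses_hodge hHD hX p)

/-- **`dim_ℂ Nᵖ(X) ≤ h^{p,p}(X)`.** [cite: Arapura2012, §11.2 (PDF p. 177)] [cite: VoisinHodgeI2002, §11.1.2 Prop. 11.20 and §11.3.1] -/
theorem BettiUniverse.finrank_algebraicClasses_le_hodgeNumber_hodge (hHD : exists_isReal_hodgeModel) (hX : IsSmoothProjective n X) (p : ℕ) :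
    Module.finrank ℂ (algebraicClasses X p) ≤ (BettiUniverse.hodge hHD hX (2 * p)).hodgeNumber p p :=
  (BettiUniverse.finrank_algebraicClasses_le_finrank_hodgeClasses_hodge hHD hX p).trans (BettiUniverse.finrank_hodgeClasses_hodge_le_hodgeNumber hHD hX p)

/-- **`Nᵖ(X) = span_ℂ (Hdgᵖ ⊗ 1) ⟺ HCᵖ(X)`** (the Hodge conjecture in codimension `p` as an equality of subspaces of `H^{2p}(X(ℂ); ℂ)`). [cite: Deligne2000, §1] [cite: VoisinHodgeI2002, §11.3.1 Conj. 11.36] -/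
theorem BettiUniverse.algebraicClasses_eq_span_image_ofRatClass_hodgeClasses_hodge_iff (hHD : exists_isReal_hodgeModel) (hX : IsSmoothProjective n X) (p : ℕ) :
    algebraicClasses X p = Submodule.span ℂ (ofRatClass (ComplexPoints X) (2 * p) '' ((BettiUniverse.hodge hHD hX (2 * p)).hodgeClasses p : Set (bettiCohomology X (2 * p)))) ↔
      ∀ c : complexBetti X (2 * p), IsRationalClass c → IsOfHodgeType n X (2 * p) p p c → c ∈ algebraicClasses X p := by
  rw [← BettiUniverse.forall_mem_hodgeClasses_hodge_iff hHD hX p]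
  constructor
  · intro h v hv
    rw [h]
    exact Submodule.subset_span ⟨v, hv, rfl⟩
  · intro h
    refine le_antisymm (BettiUniverse.algebraicClasses_le_span_image_ofRatClass_hodgeClasses_hodge hHD hX p) (Submodule.span_le.2 ?_)
    rintro _ ⟨v, hv, rfl⟩
    exact h v hv

/-- **`dim_ℂ Nᵖ(X) = dim_ℚ Hdgᵖ(H^{2p}(X)) ⟺ HCᵖ(X)`**: the Hodge conjecture in codimension `p` is ONE rank equality (`Nᵖ ⊆ span_ℂ(Hdgᵖ ⊗ 1)` of dimension `dim_ℚ Hdgᵖ`; equal dimension ⟺ equal).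
[cite: Deligne2000, §1] [cite: VoisinHodgeI2002, §11.3.1 Conj. 11.36, Prop. 11.20 and §7.1.1] -/
theorem BettiUniverse.finrank_algebraicClasses_eq_finrank_hodgeClasses_hodge_iff (hHD : exists_isReal_hodgeModel) (hX : IsSmoothProjective n X) (p : ℕ) :
    Module.finrank ℂ (algebraicClasses X p) = Module.finrank ℚ ((BettiUniverse.hodge hHD hX (2 * p)).hodgeClasses p) ↔
      ∀ c : complexBetti X (2 * p), IsRationalClass c → IsOfHodgeType n X (2 * p) p p c → c ∈ algebraicClasses X p := by
  haveI := finite_complexBetti hX (2 * p)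
  rw [← BettiUniverse.algebraicClasses_eq_span_image_ofRatClass_hodgeClasses_hodge_iff hHD hX p, ← BettiUniverse.finrank_span_image_ofRatClass ((BettiUniverse.hodge hHD hX (2 * p)).hodgeClasses p)]
  exact ⟨fun h ↦ Submodule.eq_of_le_of_finrank_eq (BettiUniverse.algebraicClasses_le_span_image_ofRatClass_hodgeClasses_hodge hHD hX p) h, fun h ↦ by rw [← h]⟩

/-! ### §3 The Hodge conjecture as finitely many rank equalities -/

/-- **`HC(X) ⟺ ∀ p, dim_ℂ Nᵖ(X) = dim_ℚ Hdgᵖ(H^{2p}(X))`.** [cite: Deligne2000, §1] [cite: VoisinHodgeI2002, §11.3.1 Conj. 11.36] -/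
theorem BettiUniverse.hodgeConjectureFor_iff_forall_finrank_algebraicClasses_eq (hHD : exists_isReal_hodgeModel) (hX : IsSmoothProjective n X) :
    HodgeConjectureFor n X ↔ ∀ p : ℕ, Module.finrank ℂ (algebraicClasses X p) = Module.finrank ℚ ((BettiUniverse.hodge hHD hX (2 * p)).hodgeClasses p) := by
  rw [hodgeConjectureFor_iff_of_hodgeModel (BettiUniverse.realHodgeModel hHD hX)]
  exact forall_congr' fun p ↦ (BettiUniverse.finrank_algebraicClasses_eq_finrank_hodgeClasses_hodge_iff hHD hX p).symm

/-- **`HC(X) ⟺ dim_ℂ Nᵖ(X) = dim_ℚ Hdgᵖ(H^{2p}(X))` for `2 ≤ p ≤ n/2` only** (the other codimensions are free: Lefschetz `(1,1)`, hard Lefschetz; g26-#5 `hodgeConjectureFor_iff_forall_two_le`).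
[cite: Deligne2000, §1] [cite: VoisinHodgeI2002, Thm. 11.30, §6.2.3 Thm. 6.25 and §11.3.1] -/
theorem BettiUniverse.hodgeConjectureFor_iff_forall_two_le_finrank_algebraicClasses_eq (hHD : exists_isReal_hodgeModel) (hX : IsSmoothProjective n X) :
    HodgeConjectureFor n X ↔
      ∀ p : ℕ, 2 ≤ p → 2 * p ≤ n → Module.finrank ℂ (algebraicClasses X p) = Module.finrank ℚ ((BettiUniverse.hodge hHD hX (2 * p)).hodgeClasses p) := by
  rw [hodgeConjectureFor_iff_forall_two_le hX]
  exact forall_congr' fun p ↦ forall_congr' fun _ ↦ forall_congr' fun _ ↦ (BettiUniverse.finrank_algebraicClasses_eq_finrank_hodgeClasses_hodge_iff hHD hX p).symm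

/-- **In the Lefschetz range the rank equality holds: `dim_ℂ Nᵖ(X) = dim_ℚ Hdgᵖ(H^{2p}(X))` for `p ≤ 1` or `p + 1 ≥ n`** (Lefschetz `(1,1)` and hard Lefschetz, the tree's `mem_algebraicClasses_of_lefschetzRange_holds`);
in particular `dim_ℂ N¹(X) = ρ(X)`. [cite: VoisinHodgeI2002, Thm. 11.30 and §6.2.3 Thm. 6.25] [cite: Arapura2012, §11.2 (PDF p. 177)] -/
theorem BettiUniverse.finrank_algebraicClasses_eq_finrank_hodgeClasses_hodge_of_lefschetzRange (hHD : exists_isReal_hodgeModel) (hX : IsSmoothProjective n X) {p : ℕ}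
    (hp : p ≤ 1 ∨ n ≤ p + 1) :
    Module.finrank ℂ (algebraicClasses X p) = Module.finrank ℚ ((BettiUniverse.hodge hHD hX (2 * p)).hodgeClasses p) :=
  (BettiUniverse.finrank_algebraicClasses_eq_finrank_hodgeClasses_hodge_iff hHD hX p).2 (mem_algebraicClasses_of_lefschetzRange_holds hX hp)

/-- **`dim_ℂ N¹(X) = ρ(X) = dim_ℚ Hdg¹(H²(X))`** (Lefschetz `(1,1)`). [cite: VoisinHodgeI2002, Thm. 11.30] [cite: Arapura2012, §11.2 (PDF p. 177)] -/
theorem BettiUniverse.finrank_algebraicClasses_one_eq_finrank_hodgeClasses_hodge (hHD : exists_isReal_hodgeModel) (hX : IsSmoothProjective n X) :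
    Module.finrank ℂ (algebraicClasses X 1) = Module.finrank ℚ ((BettiUniverse.hodge hHD hX (2 * 1)).hodgeClasses 1) :=
  BettiUniverse.finrank_algebraicClasses_eq_finrank_hodgeClasses_hodge_of_lefschetzRange hHD hX (Or.inl le_rfl)

/-- **`HC(X⁴) ⟺ dim_ℂ N²(X) = dim_ℚ Hdg²(H⁴(X))`** for a smooth projective complex fourfold. [cite: Deligne2000, §1] [cite: VoisinHodgeI2002, Thm. 11.30, Thm. 6.25 and §11.3.1] -/
theorem BettiUniverse.hodgeConjectureFor_iff_finrank_algebraicClasses_two_eq_of_dim_eq_four (hHD : exists_isReal_hodgeModel) (hX : IsSmoothProjective 4 X) :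
    HodgeConjectureFor 4 X ↔ Module.finrank ℂ (algebraicClasses X 2) = Module.finrank ℚ ((BettiUniverse.hodge hHD hX (2 * 2)).hodgeClasses 2) := by
  rw [BettiUniverse.hodgeConjectureFor_iff_forall_two_le_finrank_algebraicClasses_eq hHD hX]
  refine ⟨fun h ↦ h 2 le_rfl (by norm_num), fun h p hp2 hpn ↦ ?_⟩
  obtain rfl : p = 2 := by omega
  exact h

/-- **`HC(X⁵) ⟺ dim_ℂ N²(X) = dim_ℚ Hdg²(H⁴(X))`** for a smooth projective complex fivefold. [cite: Deligne2000, §1] [cite: VoisinHodgeI2002, Thm. 11.30, Thm. 6.25 and §11.3.1] -/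
theorem BettiUniverse.hodgeConjectureFor_iff_finrank_algebraicClasses_two_eq_of_dim_eq_five (hHD : exists_isReal_hodgeModel) (hX : IsSmoothProjective 5 X) :
    HodgeConjectureFor 5 X ↔ Module.finrank ℂ (algebraicClasses X 2) = Module.finrank ℚ ((BettiUniverse.hodge hHD hX (2 * 2)).hodgeClasses 2) := by
  rw [BettiUniverse.hodgeConjectureFor_iff_forall_two_le_finrank_algebraicClasses_eq hHD hX]
  refine ⟨fun h ↦ h 2 le_rfl (by norm_num), fun h p hp2 hpn ↦ ?_⟩
  obtain rfl : p = 2 := by omega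
  exact h

/-- **`HC(X⁶) ⟺ dim_ℂ N² = dim_ℚ Hdg²(H⁴) ∧ dim_ℂ N³ = dim_ℚ Hdg³(H⁶)`** for a smooth projective complex sixfold. [cite: Deligne2000, §1] [cite: VoisinHodgeI2002, Thm. 11.30, Thm. 6.25 and §11.3.1] -/
theorem BettiUniverse.hodgeConjectureFor_iff_finrank_algebraicClasses_eq_of_dim_eq_six (hHD : exists_isReal_hodgeModel) (hX : IsSmoothProjective 6 X) :
    HodgeConjectureFor 6 X ↔
      Module.finrank ℂ (algebraicClasses X 2) = Module.finrank ℚ ((BettiUniverse.hodge hHD hX (2 * 2)).hodgeClasses 2) ∧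
        Module.finrank ℂ (algebraicClasses X 3) = Module.finrank ℚ ((BettiUniverse.hodge hHD hX (2 * 3)).hodgeClasses 3) := by
  rw [BettiUniverse.hodgeConjectureFor_iff_forall_two_le_finrank_algebraicClasses_eq hHD hX]
  refine ⟨fun h ↦ ⟨h 2 le_rfl (by norm_num), h 3 (by norm_num) (by norm_num)⟩, fun h p hp2 hpn ↦ ?_⟩
  rcases (by omega : p = 2 ∨ p = 3) with rfl | rfl
  · exact h.1
  · exact h.2

/-- **Under `HCᵖ` and `p + p' = n`: `dim_ℂ Nᵖ = dim_ℚ Hdgᵖ = dim_ℚ Hdg^{p'} ≥ dim_ℂ N^{p'}`** — with the hard Lefschetz symmetry of the Hodge-class ranks (g26-#4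
`BettiUniverse.finrank_hodgeClasses_hodge_eq_of_add_eq`), the Hodge conjecture in codimension `p` bounds the algebraic classes of the dual codimension: `dim_ℂ N^{p'}(X) ≤ dim_ℂ Nᵖ(X)`.
[cite: VoisinHodgeI2002, §6.2.3 Thm. 6.25, Rem. 6.27, Prop. 11.20 and §11.3.1] -/
theorem BettiUniverse.finrank_algebraicClasses_dual_le_of_hodgeClasses_algebraic (hHD : exists_isReal_hodgeModel) (hX : IsSmoothProjective n X) {p p' : ℕ} (hpp' : p + p' = n)
    (hHC : ∀ c : complexBetti X (2 * p), IsRationalClass c → IsOfHodgeType n X (2 * p) p p c → c ∈ algebraicClasses X p) :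
    Module.finrank ℂ (algebraicClasses X p') ≤ Module.finrank ℂ (algebraicClasses X p) := by
  rw [(BettiUniverse.finrank_algebraicClasses_eq_finrank_hodgeClasses_hodge_iff hHD hX p).2 hHC, BettiUniverse.finrank_hodgeClasses_hodge_eq_of_add_eq hHD hX hpp']
  exact BettiUniverse.finrank_algebraicClasses_le_finrank_hodgeClasses_hodge hHD hX p'

end Literature.AlgebraicGeometry.HodgeTheory

end
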